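import Literature.Computability.AlgebraicComplexity.PlethysmStability
import HarnessLib

/-!
# No short first rows in `Sym^d Sym^n V`: the plethysm coefficient `a_λ(d[n])` vanishes for
# `λ₁ < n` (`d ≥ 1`)

Topic `Literature/Computability/AlgebraicComplexity`, continuing `PlethysmStability.lean` (its
conventions: the word model `wordRep k N (D m)` of `V^{⊗ Dm}`, `V = k^N`, positions `Fin (D * m)`
in `D` blocks of `m` (`blockIdx`), the wreath product `S_D ≀ S_m = blockPerms D m` and its
unnormalised symmetriser `Σ = blockSymmetrizer k D m`, standard fillings `T : StdFilling (D m) Y`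
and their polytabloids `e_T`; BIP (4.1): `Sym^D Sym^m V = (⊗^{Dm} V)^{S_D ≀ S_m}`, and BIP
Prop. 3.3 / Prop. 4.5: the `S_D ≀ S_m`-invariant highest-weight vectors of weight `λ` — counted
by the plethysm coefficient `a_λ(D[m])` — are spanned by the `Σ e_T`, `T` standard of shape `λ`),
in the manner of the sibling file `PlethysmHookVanishing.lean`.

## Result

**Gesmundo–Ikenmeyer–Panova 2017, Prop. 13** ("If `λ₁ < m`, then `a_λ(d[m]) = 0`", for `d ≥ 1`;
GIP prove it through Gay's bound `a_λ(d[m]) ≤ K_{λ, d×m}` and the pigeonhole principle: "for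
every placement of `m` 1s to the boxes of `λ` we will end up with at least one column containing
the number 1 at least twice" [GesmundoIkenmeyerPanova2017, §7]). Here the same pigeonhole is run
directly on BIP's tableau generators, with no Kostka numbers:

1. `StdFilling.blockSymmetrizer_polytabloid_eq_zero_of_rowLen_lt`: if the first row of `Y` is
   shorter than the block size `m` (and there is at least one block), then for EVERY standard
   filling `T` of `Y` two of the `m` positions of block `0` lie in one column of `T` (the columns
   of `Y` are fewer than `m`), so `Σ e_T = 0` by BIP Lemma 4.3(1)
   (`StdFilling.blockSymmetrizer_polytabloid_eq_zero`: "If the same letter appears in a column of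
   `T` more than once, then `v_T = 0`").
2. `eq_zero_of_mem_highestWeightSpace_wordRep_of_rowLen_lt`: hence the word model of `V^{⊗ Dm}`
   has no nonzero `S_D ≀ S_m`-invariant highest-weight vector of weight `λ` with `λ₁ < m`, `D ≥ 1`
   (`|S_D ≀ S_m| · x = ∑_T a_T Σ e_T = 0`, BIP Prop. 3.3 in basis form), i.e.
   `HWV_λ(Sym^D Sym^m V) = 0`.
3. `eq_zero_of_mem_highestWeightSpace_coordRep_of_first_lt`: through the polarisation dictionary
   `wordOfForm` of `PlethysmStability.lean` §5, `k[Sym^n (k^σ)]_d` (`d ≥ 1`) has no nonzero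
   highest-weight vector of `coordRep` of the dual weight `λ^*` when `λ₁ < n` (characteristic
   zero): the plethysm coefficient `a_λ(d[n])` vanishes. (For `d = 0` the statement is false —
   the constants are highest-weight vectors of weight `0 = ∅^*` — whence `NeZero d`.)

The classical reading: every irreducible constituent `{λ}` of `Sym^d Sym^n V ⊆ ⊗^d Sym^n V` has
`λ₁ ≥ n` (Young's rule: the constituents of `Sym^n V ⊗ W` arise by adding horizontal strips).

## References

* F. Gesmundo, C. Ikenmeyer, G. Panova, *Geometric complexity theory and matrix powering*,
  Diff. Geom. Appl. 55 (2017) 106–127 = arXiv:1611.00827, Prop. 13 and §7 (Proof of Prop. 13: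
  `a_λ(d[m]) ≤ K_{λ,d×m}` and the pigeonhole principle). [key `GesmundoIkenmeyerPanova2017`]
* P. Bürgisser, C. Ikenmeyer, G. Panova, *No occurrence obstructions in geometric complexity
  theory*, J. AMS 32 (2019) = arXiv:1604.06431v3: §3(b) Prop. 3.3, §4 (4.1), Lemma 4.3(1),
  Prop. 4.5. [key `BurgisserIkenmeyerPanovaJAMS2019`]

## Mathlib and tree

Mathlib: `Finset.exists_ne_map_eq_of_card_lt_of_maps_to` (pigeonhole), `finProdFinEquiv`,
`YoungDiagram.mem_iff_lt_rowLen`, `YoungDiagram.rowLen_anti`. Tree (`PlethysmStability`,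
`SchurWeylPlethysmHwMultiplicityProofs`, `TensorWordModel`, `StandardFillings`): `blockIdx`,
`blockIdx_finProdFinEquiv`, `StdFilling.blockSymmetrizer_polytabloid_eq_zero` (Lemma 4.3(1)),
`exists_sum_smul_polytabloid_eq`, `blockSymmetrizer_apply_of_forall_wordPerm_eq`,
`card_blockPermsFinset_pos`, `wordOfForm`, `wordOfForm_mem_highestWeightSpace`,
`wordPerm_wordOfForm`, `eq_of_wordOfForm_eq`, `ydWeight_youngDiagram`, `rowLen_youngDiagram`,
`fst_lt_of_mem_youngDiagram`. No new definitions.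
-/

open scoped BigOperators

namespace Literature.Computability.AlgebraicComplexity

open Literature.NumberTheory.DiophantineGeometry (Word wordRep wordPerm highestWeightSpace
  StdFilling ydWeight Weight)

/-! ### 1. The pigeonhole: two entries of block `0` in one column -/

section WordModel

variable {k : Type*} [Field k] [CharZero k] {N D m : ℕ} {Y : YoungDiagram}

/-- **Short first row ⇒ `Σ e_T = 0` for every standard filling** (GIP Prop. 13 at the level of
BIP's tableau generators). If `Y` has fewer than `m` columns (`|row 0| < m`) and there is a
block (`D ≠ 0`), then two of the `m` positions of block `0` lie in one column of `T`
(pigeonhole: the column of a cell of `Y` is `< |row 0|`), and BIP Lemma 4.3(1) gives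
`Σ e_T = 0`. GIP: "the pigeonhole principle says that for every placement of `m` 1s to the
boxes of `λ` we will end up with at least one column containing the number 1 at least twice."
[cite: GesmundoIkenmeyerPanova2017, Prop. 13 (proof, §7)] -/
theorem _root_.Literature.NumberTheory.DiophantineGeometry.StdFilling.blockSymmetrizer_polytabloid_eq_zero_of_rowLen_lt
    (hN : ∀ x ∈ Y.cells, x.1 < N) [NeZero D] (T : StdFilling (D * m) Y)
    (hrow : Y.rowLen 0 < m) : blockSymmetrizer k D m (T.polytabloid k hN) = 0 := by
  classical
  -- the positions of block `0` and their columns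
  set pos : Fin m → Fin (D * m) := fun p => finProdFinEquiv ((0 : Fin D), p) with hpos
  have hmaps : ∀ p ∈ (Finset.univ : Finset (Fin m)),
      (T.1 (pos p)).2 ∈ Finset.range (Y.rowLen 0) := by
    intro p _
    rw [Finset.mem_range]
    have hmem : ((T.1 (pos p)).1, (T.1 (pos p)).2) ∈ Y := by
      rw [Prod.mk.eta]
      exact T.mem (pos p)
    rw [YoungDiagram.mem_iff_lt_rowLen] at hmem
    exact lt_of_lt_of_le hmem (Y.rowLen_anti 0 _ (Nat.zero_le _))
  have hcard : (Finset.range (Y.rowLen 0)).card < (Finset.univ : Finset (Fin m)).card := by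
    rw [Finset.card_range, Finset.card_univ, Fintype.card_fin]
    exact hrow
  obtain ⟨p, -, q, -, hpq, hcol⟩ := Finset.exists_ne_map_eq_of_card_lt_of_maps_to hcard hmaps
  have hne : pos p ≠ pos q := fun h =>
    hpq (congrArg Prod.snd (finProdFinEquiv.injective h))
  have hblk : blockIdx D m (pos p) = blockIdx D m (pos q) := by
    rw [hpos, blockIdx_finProdFinEquiv, blockIdx_finProdFinEquiv]
  exact T.blockSymmetrizer_polytabloid_eq_zero hN hne hcol hblk

/-- **No wreath-invariant highest-weight vectors with a short first row in the word model.**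
If `|Y| = D m` with `D ≠ 0`, `Y` has fewer than `N` rows and fewer than `m` columns, then every
`S_D ≀ S_m`-invariant highest-weight vector `x` of weight `λ = ydWeight N Y` of the word model of
`V^{⊗ Dm}` vanishes: `|S_D ≀ S_m| · x = Σ x = ∑_T a_T Σ e_T = 0` over the standard fillings
(BIP Prop. 3.3 in basis form), characteristic zero. That is, `HWV_λ(Sym^D Sym^m V) = 0`: the
plethysm coefficient `a_λ(D[m])` vanishes for `λ₁ < m`.
[cite: GesmundoIkenmeyerPanova2017, Prop. 13] -/
theorem eq_zero_of_mem_highestWeightSpace_wordRep_of_rowLen_lt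
    (hN : ∀ x ∈ Y.cells, x.1 < N) (hd : Y.cells.card = D * m) [NeZero D]
    (hrow : Y.rowLen 0 < m)
    {x : Word N (D * m) → k} (hx : x ∈ highestWeightSpace (wordRep k N (D * m)) (ydWeight N Y))
    (hinv : ∀ τ ∈ blockPerms D m, wordPerm k τ x = x) : x = 0 := by
  classical
  obtain ⟨a, ha⟩ := exists_sum_smul_polytabloid_eq hN hd hx
  have hS : (blockPermsFinset D m).card • x =
      ∑ T, a T • blockSymmetrizer k D m (T.polytabloid k hN) := by
    rw [← blockSymmetrizer_apply_of_forall_wordPerm_eq k hinv, ← ha, map_sum]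
    simp_rw [map_smul]
  have h0 : (blockPermsFinset D m).card • x = 0 := by
    rw [hS]
    exact Finset.sum_eq_zero fun T _ => by
      rw [T.blockSymmetrizer_polytabloid_eq_zero_of_rowLen_lt hN hrow, smul_zero]
  rw [← Nat.cast_smul_eq_nsmul k] at h0
  exact (smul_eq_zero.mp h0).resolve_left (Nat.cast_ne_zero.mpr card_blockPermsFinset_pos.ne')

end WordModel

/-! ### 2. Back to `k[Sym^n]_d`: no highest-weight vectors of dual weight `λ^*` with `λ₁ < n` -/

section Polynomials

open MvPolynomial

variable {k : Type*} [Field k] [CharZero k] {σ : Type*} [LinearOrder σ] [Fintype σ] {M : ℕ}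
  {n d : ℕ}

/-- **GIP Prop. 13: no highest-weight vectors with a short first row in `k[Sym^n (k^σ)]_d`**
(plethysm coefficients `a_λ(d[n]) = 0` for `λ₁ < n`, `d ≥ 1`). Let `ρ : Fin M ≃ σ` be
order-reversing and `λ ⊢ d·n` (`d ≠ 0`) a partition with at most `M` parts and largest part
`λ₁ < n`. Then every form `h` of degree `d` on `Sym^n (k^σ)` which is a highest-weight vector of
`coordRep` of weight `χ` with `-χ(ρ i) = λ_{i+1}` (i.e. `χ = λ^*` read through `ρ`) is zero: its
transported polarisation `wordOfForm ρ n d h` is an `S_d ≀ S_n`-invariant highest-weight vector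
of weight `λ` of the word model (`wordOfForm_mem_highestWeightSpace`, `wordPerm_wordOfForm`),
hence zero (`eq_zero_of_mem_highestWeightSpace_wordRep_of_rowLen_lt`), and the polarisation is
injective (`eq_of_wordOfForm_eq`). Characteristic zero. GIP: "If `λ₁ < m`, then `a_λ(d[m]) = 0`"
(their `m` is the inner degree `n` here; `d ≥ 1` is implicit in print — for `d = 0` the empty
partition does occur, `a_∅(0[m]) = 1`). [cite: GesmundoIkenmeyerPanova2017, Prop. 13] -/
theorem eq_zero_of_mem_highestWeightSpace_coordRep_of_first_lt {ρ : Fin M ≃ σ} (hρ : StrictAnti ρ)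
    [NeZero d] (lam : Nat.Partition (d * n)) (hlam : lam.parts.card ≤ M)
    (hfirst : lam.sortedParts.getD 0 0 < n)
    {h : MvPolynomial (DegIdx σ n) k} (hh : h.IsHomogeneous d) {χ : Weight σ}
    (hχ : ∀ i, -χ (ρ i) = Weight.ofPartition M lam i)
    (hhw : h ∈ highestWeightSpace (coordRep σ k n) χ) : h = 0 := by
  classical
  set Y := lam.youngDiagram with hY
  have hN : ∀ x ∈ Y.cells, x.1 < M := fun x hx =>
    Literature.NumberTheory.DiophantineGeometry.fst_lt_of_mem_youngDiagram lam hlam hx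
  have hd : Y.cells.card = d * n := lam.card_cells_youngDiagram
  have hrow : Y.rowLen 0 < n := by
    rw [hY, Literature.NumberTheory.DiophantineGeometry.rowLen_youngDiagram lam 0]
    exact hfirst
  have hx : wordOfForm ρ n d h ∈ highestWeightSpace (wordRep k M (d * n)) (ydWeight M Y) := by
    have := wordOfForm_mem_highestWeightSpace hρ hh hhw
    rwa [show (fun i => -χ (ρ i)) = ydWeight M Y from by
      rw [hY, Literature.NumberTheory.DiophantineGeometry.ydWeight_youngDiagram]
      funext i
      exact hχ i] at this
  have hinv : ∀ τ ∈ blockPerms d n, wordPerm k τ (wordOfForm ρ n d h) = wordOfForm ρ n d h :=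
    fun τ hτ => wordPerm_wordOfForm ρ h hτ
  have hx0 : wordOfForm ρ n d h = 0 :=
    eq_zero_of_mem_highestWeightSpace_wordRep_of_rowLen_lt hN hd hrow hx hinv
  refine eq_of_wordOfForm_eq ρ hh (isHomogeneous_zero _ _ _) ?_
  rw [hx0]
  funext w
  rw [Pi.zero_apply, wordOfForm_apply, polarize, arrOf, coeff_zero, zero_div]

/-- The same in subspace form: for `λ ⊢ d·n`, `d ≠ 0`, `λ₁ < n`, at most `M` parts, the
highest-weight space of `coordRep σ k n` of a weight `χ` with `-χ(ρ i) = λ_{i+1}` contains no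
nonzero FORM OF DEGREE `d`; combined with "a weight pins the degree"
(`isHomogeneous_of_mem_highestWeightSpace`, `n ≠ 0`) every vector of that space is such a form,
so the space is `⊥` — `HWV_{λ}(Sym^d Sym^n V) = 0`, `a_λ(d[n]) = 0`.
[cite: GesmundoIkenmeyerPanova2017, Prop. 13] -/
theorem highestWeightSpace_coordRep_eq_bot_of_first_lt {ρ : Fin M ≃ σ} (hρ : StrictAnti ρ)
    [NeZero d] (lam : Nat.Partition (d * n)) (hlam : lam.parts.card ≤ M)
    (hfirst : lam.sortedParts.getD 0 0 < n) {χ : Weight σ}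
    (hχ : ∀ i, -χ (ρ i) = Weight.ofPartition M lam i)
    (hsize : χ.size = -((n * d : ℕ) : ℤ)) :
    highestWeightSpace (coordRep σ k n) χ = ⊥ := by
  have hn : n ≠ 0 := by
    rintro rfl
    exact Nat.not_lt_zero _ hfirst
  rw [Submodule.eq_bot_iff]
  intro h hh
  exact eq_zero_of_mem_highestWeightSpace_coordRep_of_first_lt hρ lam hlam hfirst
    (isHomogeneous_of_mem_highestWeightSpace hn hh hsize) hχ hh

end Polynomials

end Literature.Computability.AlgebraicComplexity
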